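import Summits.KontsevichZagierPeriods.KontsevichZagierPeriods.Theorems.FurushoPentagonPentagonInKZCornerCubes
import Summits.KontsevichZagierPeriods.KontsevichZagierPeriods.Theorems.FurushoPentagonPentagonInKZCornerSemialg
import Summits.KontsevichZagierPeriods.KontsevichZagierPeriods.Theorems.FurushoPentagonPentagonInKZCornerEngineMoveAux
import Summits.KontsevichZagierPeriods.KontsevichZagierPeriods.Theorems.FurushoPentagonPentagonInKZCornerEngineEulerAux
import Summits.KontsevichZagierPeriods.KontsevichZagierPeriods.Theorems.FurushoPentagonPentagonInKZCornerEngineExistEAux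

/-!
# `PentagonInKZ`, line `edge-normal-newton-leibniz`: corner engine — the Euler step `stepA_euler`

Step A.3 of the abstract corner engine (proof of `cornerEngine_uniformlyNull`, crux
`FurushoPentagon.PentagonInKZ`, stmt-KontsevichZagierPeriods-11348), in the engine's abstract
signature (hypothesised dictionaries, ONE hypothesis bundle `H`).

THE STATEMENT.  In degree `k + (l''+1)` with parameters `θ'' ∈ [0,1]^{e+2}` (`θ₀ = init init θ''`,
`s, s'` the last two parameters, `Ξ₂ = Ξ(θ₀) s`, `Η₂ = Η(θ₀) s'`, `ρ₂ = (σ Ξ Η)(θ₀)`), the class of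
the `dB`-term `W₂ = ⟦ρ₂ fd_a(Ξ₂, Η₂) ∂_Η B^{μ∘op a}(x, y; Ξ₂, Η₂)⟧` equals the class of the
level-`(k + l'')` integrand `E = ⟦ρ₂ fd_a(Ξ₂,Η₂) Σ_b gd_b(Ξ₂,Η₂) B^{(μ∘op a)∘opV b}(x', y'; Ξ₂, Η₂)⟧`.

THE PROOF.  (1) Move the outermost transverse variable `y₀` to the last slot (rule (2),
`CornerEngineMove.moveY0_rep`).  (2) Rule (3) along `y₀` over the open base cube
(`CornerCubes.cls_newtonLeibniz_open`) with the primitive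
`G = (ρ₂ fd_a / Η₂) · y₀ · B^ν(x', y₀ :: y'; Ξ₂, Η₂)`: by Euler homogeneity
(`CornerEngineEuler.hasDerivAt_mul_Bf`) `∂_{y₀} G = ρ₂ fd_a ∂_Η B`, the band integrand; `G` is
continuous in `y₀ ∈ [0,1]`, vanishes at `y₀ = 0`, and at `y₀ = 1` peels by (★B)
(`CornerEngineMove.starB`) into `E`'s integrand; at base points where `σ(θ₀) = 0` everything
vanishes, elsewhere the normalisation of `σ` gives `Ξ₂ > 0`, `Η₂ ≠ 0`.  Semialgebraicity of `G`:
compositions with coordinate projections (`qe_comp_proj`, coordinates) and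
`qe_sa_Bf`.

References: [KontsevichZagier2001, §1.2 rules (2), (3)]; V. G. Drinfeld, Leningrad Math. J. 2
(1991), §2; [BochnakCosteRoy1998, Prop. 2.2.6].
-/

noncomputable section

open Set MeasureTheory
open Literature.NumberTheory.Transcendental
open Literature.ModelTheory.ExponentialFields (IsSemialgebraic)

namespace Summit.KontsevichZagierPeriods.FurushoPentagon.PentagonInKZ

section AbstractEngine

variable {m N : ℕ} {ℓ ℓ' : Fin (m + 2)} {α β : ℚ}
  {Zq : Fin (m + 2) → (DrinfeldKohnoTrunc ℚ (Fin 4) N)} {wZ : ∀ {n : ℕ}, (Fin n → Fin (m + 2)) → (DrinfeldKohnoTrunc ℚ (Fin 4) N)}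
  {fd gd dd : Fin (m + 2) → ℝ → ℝ → ℝ}
  {Ht Vt dHt dVt : ∀ {n : ℕ}, (Fin n → Fin (m + 2)) → (Fin n → ℝ) → ℝ → ℝ → ℝ}
  {op opV : Fin (m + 2) → (DrinfeldKohnoTrunc ℚ (Fin 4) N) →ₗ[ℚ] (DrinfeldKohnoTrunc ℚ (Fin 4) N)}
  {Af Bf dAf dBf F : ((DrinfeldKohnoTrunc ℚ (Fin 4) N) →ₗ[ℚ] ℚ) → ∀ {k l : ℕ}, (Fin k → ℝ) → (Fin l → ℝ) → ℝ → ℝ → ℝ}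
  {Xb : ∀ k l e : ℕ, (Fin (k + l + e) → ℝ) → Fin k → ℝ}
  {Yb : ∀ k l e : ℕ, (Fin (k + l + e) → ℝ) → Fin l → ℝ}
  {Θb : ∀ k l e : ℕ, (Fin (k + l + e) → ℝ) → Fin e → ℝ}

variable (H :
    (∀ {n : ℕ} (U : Fin n → Fin (m + 2)), wZ U = ((List.ofFn U).map Zq).prod) ∧
    (∀ (a : Fin (m + 2)) (X : (DrinfeldKohnoTrunc ℚ (Fin 4) N)), op a X = if a = ℓ then Zq ℓ * X - X * Zq ℓ else Zq a * X) ∧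
    (∀ (b : Fin (m + 2)) (X : (DrinfeldKohnoTrunc ℚ (Fin 4) N)), opV b X = if b = ℓ' then Zq ℓ' * X - X * Zq ℓ' else Zq b * X) ∧
    (∀ (μ : (DrinfeldKohnoTrunc ℚ (Fin 4) N) →ₗ[ℚ] ℚ) {k l : ℕ} (x : Fin k → ℝ) (y : Fin l → ℝ) (ξ η : ℝ), Af μ x y ξ η = ∑ U : Fin k → Fin (m + 2), ∑ V : Fin l → Fin (m + 2), (μ (wZ U * wZ V) : ℝ) * (Ht U x ξ η * Vt V y 0 η)) ∧
    (∀ (μ : (DrinfeldKohnoTrunc ℚ (Fin 4) N) →ₗ[ℚ] ℚ) {k l : ℕ} (x : Fin k → ℝ) (y : Fin l → ℝ) (ξ η : ℝ), Bf μ x y ξ η = ∑ U : Fin k → Fin (m + 2), ∑ V : Fin l → Fin (m + 2), (μ (wZ V * wZ U) : ℝ) * (Vt V y ξ η * Ht U x ξ 0)) ∧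
    (∀ (μ : (DrinfeldKohnoTrunc ℚ (Fin 4) N) →ₗ[ℚ] ℚ) {k l : ℕ} (x : Fin k → ℝ) (y : Fin l → ℝ) (ξ η : ℝ), dAf μ x y ξ η = ∑ U : Fin k → Fin (m + 2), ∑ V : Fin l → Fin (m + 2), (μ (wZ U * wZ V) : ℝ) * (dHt U x ξ η * Vt V y 0 η)) ∧
    (∀ (μ : (DrinfeldKohnoTrunc ℚ (Fin 4) N) →ₗ[ℚ] ℚ) {k l : ℕ} (x : Fin k → ℝ) (y : Fin l → ℝ) (ξ η : ℝ), dBf μ x y ξ η = ∑ U : Fin k → Fin (m + 2), ∑ V : Fin l → Fin (m + 2), (μ (wZ V * wZ U) : ℝ) * (dVt V y ξ η * Ht U x ξ 0)) ∧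
    (∀ (μ : (DrinfeldKohnoTrunc ℚ (Fin 4) N) →ₗ[ℚ] ℚ) {k l : ℕ} (x : Fin k → ℝ) (y : Fin l → ℝ) (ξ η : ℝ), F μ x y ξ η = Af μ x y ξ η - Bf μ x y ξ η) ∧
    (∀ (k l e : ℕ) (z : Fin (k + l + e) → ℝ), Xb k l e z = fun i => z (Fin.castAdd e (Fin.castAdd l i))) ∧
    (∀ (k l e : ℕ) (z : Fin (k + l + e) → ℝ), Yb k l e z = fun j => z (Fin.castAdd e (Fin.natAdd k j))) ∧
    (∀ (k l e : ℕ) (z : Fin (k + l + e) → ℝ), Θb k l e z = fun s => z (Fin.natAdd (k + l) s)) ∧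
    (∀ (U : Fin 0 → Fin (m + 2)) (x : Fin 0 → ℝ) (ξ η : ℝ), Ht U x ξ η = 1) ∧
    (∀ (V : Fin 0 → Fin (m + 2)) (y : Fin 0 → ℝ) (ξ η : ℝ), Vt V y ξ η = 1) ∧
    (∀ (U : Fin 0 → Fin (m + 2)) (x : Fin 0 → ℝ) (ξ η : ℝ), dHt U x ξ η = 0) ∧
    (∀ (V : Fin 0 → Fin (m + 2)) (y : Fin 0 → ℝ) (ξ η : ℝ), dVt V y ξ η = 0) ∧
    (∀ {k : ℕ} (U : Fin (k + 1) → Fin (m + 2)) (x : Fin (k + 1) → ℝ) (η : ℝ), Ht U x 0 η = 0) ∧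
    (∀ {l : ℕ} (V : Fin (l + 1) → Fin (m + 2)) (y : Fin (l + 1) → ℝ) (ξ : ℝ), Vt V y ξ 0 = 0) ∧
    (∀ t y : ℝ, fd ℓ t y = 1 / t) ∧
    (∀ x s : ℝ, gd ℓ' x s = 1 / s) ∧
    (∀ x y : ℝ, dd ℓ x y = 0) ∧
    (∀ x y : ℝ, dd ℓ' x y = 0) ∧
    (∀ (μ : (DrinfeldKohnoTrunc ℚ (Fin 4) N) →ₗ[ℚ] ℚ) {k : ℕ} (x₀ : ℝ) (x' : Fin k → ℝ) (ξ η : ℝ), ∑ U : Fin (k + 1) → Fin (m + 2), (μ (wZ U) : ℝ) * Ht U (Fin.cons x₀ x') ξ η = (∑ a : Fin (m + 2), (if a = ℓ then 1 / x₀ else ξ * fd a (ξ * x₀) η) * ∑ U' : Fin k → Fin (m + 2), (μ (Zq a * wZ U') : ℝ) * Ht U' x' (ξ * x₀) η) - (1 / x₀) * ∑ U' : Fin k → Fin (m + 2), (μ (wZ U' * Zq ℓ) : ℝ) * Ht U' x' (ξ * x₀) η) ∧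
    (∀ (μ : (DrinfeldKohnoTrunc ℚ (Fin 4) N) →ₗ[ℚ] ℚ) {l : ℕ} (y₀ : ℝ) (y' : Fin l → ℝ) (ξ η : ℝ), ∑ V : Fin (l + 1) → Fin (m + 2), (μ (wZ V) : ℝ) * Vt V (Fin.cons y₀ y') ξ η = (∑ b : Fin (m + 2), (if b = ℓ' then 1 / y₀ else η * gd b ξ (η * y₀)) * ∑ V' : Fin l → Fin (m + 2), (μ (Zq b * wZ V') : ℝ) * Vt V' y' ξ (η * y₀)) - (1 / y₀) * ∑ V' : Fin l → Fin (m + 2), (μ (wZ V' * Zq ℓ') : ℝ) * Vt V' y' ξ (η * y₀)) ∧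
    (∀ (μ : (DrinfeldKohnoTrunc ℚ (Fin 4) N) →ₗ[ℚ] ℚ) {l : ℕ} (P Q : (DrinfeldKohnoTrunc ℚ (Fin 4) N)) (y : Fin l → ℝ) (η : ℝ), (∀ i, 0 < y i ∧ y i < 1) → 0 < η → η ≤ (β : ℝ) → ∑ V : Fin l → Fin (m + 2), (μ (P * (Zq ℓ * wZ V - wZ V * Zq ℓ) * Q) : ℝ) * Vt V y 0 η = 0) ∧
    (∀ (μ : (DrinfeldKohnoTrunc ℚ (Fin 4) N) →ₗ[ℚ] ℚ) {k : ℕ} (P Q : (DrinfeldKohnoTrunc ℚ (Fin 4) N)) (x : Fin k → ℝ) (ξ : ℝ), (∀ i, 0 < x i ∧ x i < 1) → 0 < ξ → ξ ≤ (α : ℝ) → ∑ U : Fin k → Fin (m + 2), (μ (P * (Zq ℓ' * wZ U - wZ U * Zq ℓ') * Q) : ℝ) * Ht U x ξ 0 = 0) ∧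
    (∀ (μ : (DrinfeldKohnoTrunc ℚ (Fin 4) N) →ₗ[ℚ] ℚ) (P Q : (DrinfeldKohnoTrunc ℚ (Fin 4) N)), μ (P * (Zq ℓ * Zq ℓ' - Zq ℓ' * Zq ℓ) * Q) = 0) ∧
    (∀ (μ : (DrinfeldKohnoTrunc ℚ (Fin 4) N) →ₗ[ℚ] ℚ) (P Q : (DrinfeldKohnoTrunc ℚ (Fin 4) N)) (x y : ℝ), 0 < x → x < (α : ℝ) → 0 < y → y < (β : ℝ) → ∑ a : Fin (m + 2), ∑ b : Fin (m + 2), (fd a x y * gd b x y) * (μ (P * (Zq a * Zq b - Zq b * Zq a) * Q) : ℝ) = 0) ∧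
    (∀ (μ : (DrinfeldKohnoTrunc ℚ (Fin 4) N) →ₗ[ℚ] ℚ) (P Q : (DrinfeldKohnoTrunc ℚ (Fin 4) N)) (s : ℝ), 0 < s → s < (β : ℝ) → ∑ b : Fin (m + 2), gd b 0 s * (μ (P * (Zq ℓ * Zq b - Zq b * Zq ℓ) * Q) : ℝ) = 0) ∧
    (∀ (μ : (DrinfeldKohnoTrunc ℚ (Fin 4) N) →ₗ[ℚ] ℚ) (P Q : (DrinfeldKohnoTrunc ℚ (Fin 4) N)) (t : ℝ), 0 < t → t < (α : ℝ) → ∑ a : Fin (m + 2), fd a t 0 * (μ (P * (Zq ℓ' * Zq a - Zq a * Zq ℓ') * Q) : ℝ) = 0) ∧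
    (∀ (a : Fin (m + 2)) (ξ η : ℝ), 0 ≤ ξ → ξ ≤ (α : ℝ) → 0 ≤ η → η ≤ (β : ℝ) → HasDerivAt (fun y => fd a ξ y) (dd a ξ η) η) ∧
    (∀ (b : Fin (m + 2)) (ξ η : ℝ), 0 ≤ ξ → ξ ≤ (α : ℝ) → 0 ≤ η → η ≤ (β : ℝ) → HasDerivAt (fun x => gd b x η) (dd b ξ η) ξ) ∧
    (∀ {k : ℕ} (U : Fin k → Fin (m + 2)) (x : Fin k → ℝ) (ξ η : ℝ), (∀ i, 0 ≤ x i ∧ x i ≤ 1) → 0 ≤ ξ → ξ ≤ (α : ℝ) → 0 ≤ η → η ≤ (β : ℝ) → HasDerivAt (fun t => Ht U x t η) (dHt U x ξ η) ξ) ∧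
    (∀ {l : ℕ} (V : Fin l → Fin (m + 2)) (y : Fin l → ℝ) (ξ η : ℝ), (∀ i, 0 ≤ y i ∧ y i ≤ 1) → 0 ≤ ξ → ξ ≤ (α : ℝ) → 0 ≤ η → η ≤ (β : ℝ) → HasDerivAt (fun s => Vt V y ξ s) (dVt V y ξ η) η) ∧
    (∀ {k : ℕ} (U : Fin (k + 1) → Fin (m + 2)) (x₀ : ℝ) (x' : Fin k → ℝ) (ξ η : ℝ), 0 < x₀ → x₀ < 1 → (∀ i, 0 ≤ x' i ∧ x' i ≤ 1) → 0 ≤ ξ → ξ ≤ (α : ℝ) → 0 ≤ η → η ≤ (β : ℝ) → HasDerivAt (fun t => t * Ht U (Fin.cons t x') ξ η) (ξ * dHt U (Fin.cons x₀ x') ξ η) x₀) ∧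
    (∀ {l : ℕ} (V : Fin (l + 1) → Fin (m + 2)) (y₀ : ℝ) (y' : Fin l → ℝ) (ξ η : ℝ), 0 < y₀ → y₀ < 1 → (∀ i, 0 ≤ y' i ∧ y' i ≤ 1) → 0 ≤ ξ → ξ ≤ (α : ℝ) → 0 ≤ η → η ≤ (β : ℝ) → HasDerivAt (fun t => t * Vt V (Fin.cons t y') ξ η) (η * dVt V (Fin.cons y₀ y') ξ η) y₀) ∧
    (∀ {k : ℕ} (U : Fin (k + 1) → Fin (m + 2)) (x' : Fin k → ℝ) (ξ η : ℝ), (∀ i, 0 ≤ x' i ∧ x' i ≤ 1) → 0 ≤ ξ → ξ ≤ (α : ℝ) → 0 ≤ η → η ≤ (β : ℝ) → ContinuousOn (fun t => t * Ht U (Fin.cons t x') ξ η) (Set.Icc 0 1)) ∧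
    (∀ {l : ℕ} (V : Fin (l + 1) → Fin (m + 2)) (y' : Fin l → ℝ) (ξ η : ℝ), (∀ i, 0 ≤ y' i ∧ y' i ≤ 1) → 0 ≤ ξ → ξ ≤ (α : ℝ) → 0 ≤ η → η ≤ (β : ℝ) → ContinuousOn (fun t => t * Vt V (Fin.cons t y') ξ η) (Set.Icc 0 1)) ∧
    (∀ {d : ℕ} {W : Set (Fin d → ℝ)}, IsSemialgebraic ℚ W → ∀ (a : Fin (m + 2)) {T Y : (Fin d → ℝ) → ℝ}, IsSemialgebraicFunOn ℚ W T → IsSemialgebraicFunOn ℚ W Y → IsSemialgebraicFunOn ℚ W fun z => fd a (T z) (Y z)) ∧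
    (∀ {d : ℕ} {W : Set (Fin d → ℝ)}, IsSemialgebraic ℚ W → ∀ (b : Fin (m + 2)) {T Y : (Fin d → ℝ) → ℝ}, IsSemialgebraicFunOn ℚ W T → IsSemialgebraicFunOn ℚ W Y → IsSemialgebraicFunOn ℚ W fun z => gd b (T z) (Y z)) ∧
    (∀ {d : ℕ} {W : Set (Fin d → ℝ)}, IsSemialgebraic ℚ W → ∀ (a : Fin (m + 2)) {T Y : (Fin d → ℝ) → ℝ}, IsSemialgebraicFunOn ℚ W T → IsSemialgebraicFunOn ℚ W Y → IsSemialgebraicFunOn ℚ W fun z => dd a (T z) (Y z)) ∧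
    (∀ {d : ℕ} {W : Set (Fin d → ℝ)}, IsSemialgebraic ℚ W → ∀ {n : ℕ} (U : Fin n → Fin (m + 2)) {X : (Fin d → ℝ) → Fin n → ℝ} {P Q : (Fin d → ℝ) → ℝ}, (∀ i, IsSemialgebraicFunOn ℚ W fun z => X z i) → IsSemialgebraicFunOn ℚ W P → IsSemialgebraicFunOn ℚ W Q → IsSemialgebraicFunOn ℚ W fun z => Ht U (X z) (P z) (Q z)) ∧
    (∀ {d : ℕ} {W : Set (Fin d → ℝ)}, IsSemialgebraic ℚ W → ∀ {n : ℕ} (V : Fin n → Fin (m + 2)) {Y : (Fin d → ℝ) → Fin n → ℝ} {P Q : (Fin d → ℝ) → ℝ}, (∀ i, IsSemialgebraicFunOn ℚ W fun z => Y z i) → IsSemialgebraicFunOn ℚ W P → IsSemialgebraicFunOn ℚ W Q → IsSemialgebraicFunOn ℚ W fun z => Vt V (Y z) (P z) (Q z)) ∧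
    (∀ {d : ℕ} {W : Set (Fin d → ℝ)}, IsSemialgebraic ℚ W → ∀ {n : ℕ} (U : Fin n → Fin (m + 2)) {X : (Fin d → ℝ) → Fin n → ℝ} {P Q : (Fin d → ℝ) → ℝ}, (∀ i, IsSemialgebraicFunOn ℚ W fun z => X z i) → IsSemialgebraicFunOn ℚ W P → IsSemialgebraicFunOn ℚ W Q → IsSemialgebraicFunOn ℚ W fun z => dHt U (X z) (P z) (Q z)) ∧
    (∀ {d : ℕ} {W : Set (Fin d → ℝ)}, IsSemialgebraic ℚ W → ∀ {n : ℕ} (V : Fin n → Fin (m + 2)) {Y : (Fin d → ℝ) → Fin n → ℝ} {P Q : (Fin d → ℝ) → ℝ}, (∀ i, IsSemialgebraicFunOn ℚ W fun z => Y z i) → IsSemialgebraicFunOn ℚ W P → IsSemialgebraicFunOn ℚ W Q → IsSemialgebraicFunOn ℚ W fun z => dVt V (Y z) (P z) (Q z)) ∧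
    (∃ C : ℝ, ∀ (a : Fin (m + 2)) (ξ η : ℝ), 0 ≤ ξ → ξ ≤ (α : ℝ) → 0 ≤ η → η ≤ (β : ℝ) → (a ≠ ℓ → |fd a ξ η| ≤ C) ∧ (a ≠ ℓ' → |gd a ξ η| ≤ C) ∧ |dd a ξ η| ≤ C ∧ (∀ η' : ℝ, 0 ≤ η' → η' ≤ (β : ℝ) → |fd a ξ η - fd a ξ η'| ≤ C * |η - η'|) ∧ (∀ ξ' : ℝ, 0 ≤ ξ' → ξ' ≤ (α : ℝ) → |gd a ξ η - gd a ξ' η| ≤ C * |ξ - ξ'|)) ∧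
    (∀ k : ℕ, ∃ C : ℝ, ∀ (U : Fin k → Fin (m + 2)) (x : Fin k → ℝ) (ξ η : ℝ), (∀ i, 0 ≤ x i ∧ x i ≤ 1) → 0 ≤ ξ → ξ ≤ (α : ℝ) → 0 ≤ η → η ≤ (β : ℝ) → |Ht U x ξ η| ≤ C ∧ |dHt U x ξ η| ≤ C ∧ (0 < k → |Ht U x ξ η| ≤ C * ξ) ∧ (∀ η' : ℝ, 0 ≤ η' → η' ≤ (β : ℝ) → |Ht U x ξ η - Ht U x ξ η'| ≤ C * ξ * |η - η'|)) ∧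
    (∀ l : ℕ, ∃ C : ℝ, ∀ (V : Fin l → Fin (m + 2)) (y : Fin l → ℝ) (ξ η : ℝ), (∀ i, 0 ≤ y i ∧ y i ≤ 1) → 0 ≤ ξ → ξ ≤ (α : ℝ) → 0 ≤ η → η ≤ (β : ℝ) → |Vt V y ξ η| ≤ C ∧ |dVt V y ξ η| ≤ C ∧ (0 < l → |Vt V y ξ η| ≤ C * η) ∧ (∀ ξ' : ℝ, 0 ≤ ξ' → ξ' ≤ (α : ℝ) → |Vt V y ξ η - Vt V y ξ' η| ≤ C * η * |ξ - ξ'|)))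

/-! ### The Euler step at a point of the open cube -/

namespace CornerEngineEuler

/-- Ranges of the dilations `Ξ s`, `Η s'` for `s, s' ∈ [0,1]`. [folklore] -/
theorem dilation_range (a c s : ℝ) (ha : 0 ≤ a) (hc : a ≤ c) (hs : 0 ≤ s) (hs1 : s ≤ 1) :
    0 ≤ a * s ∧ a * s ≤ c :=
  ⟨mul_nonneg ha hs, (mul_le_of_le_one_right ha hs1).trans hc⟩

include H in
/-- **The Euler step, pointwise**: for `x', y'` and the parameters `Θ₂` in open cubes, the
primitive `t ↦ (ρ₂ fd_a / Η₂) · t · B(x', t :: y'; Ξ₂, Η₂)` is continuous on `[0,1]`, has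
derivative the band integrand `ρ₂ fd_a ∂_Η B(x', t :: y'; Ξ₂, Η₂)` on `(0,1)`, and its increment
over `[0,1]` is, by (★B), the level-`(k+l'')` integrand. [cite: KontsevichZagier2001, §1.2 rule (3)] -/
theorem euler_point (μ : (DrinfeldKohnoTrunc ℚ (Fin 4) N) →ₗ[ℚ] ℚ) (k l'' e : ℕ) (Ξ Η σ : (Fin e → ℝ) → ℝ)
    (hΞΗ : ∀ θ ∈ KZ.cube e, 0 ≤ Ξ θ ∧ Ξ θ ≤ (α : ℝ) ∧ 0 ≤ Η θ ∧ Η θ ≤ (β : ℝ))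
    (hσ0 : ∀ θ ∈ KZ.cube e, Ξ θ = 0 ∨ Η θ = 0 → σ θ = 0)
    (a : Fin (m + 2)) (Ξ₂ Η₂ ρ₂ : (Fin (e + 2) → ℝ) → ℝ)
    (hΞ₂ : ∀ θ'', Ξ₂ θ'' = Ξ (Fin.init (Fin.init θ'')) * θ'' (Fin.castSucc (Fin.last e)))
    (hΗ₂ : ∀ θ'', Η₂ θ'' = Η (Fin.init (Fin.init θ'')) * θ'' (Fin.last (e + 1)))
    (hρ₂ : ∀ θ'', ρ₂ θ'' = σ (Fin.init (Fin.init θ'')) * Ξ (Fin.init (Fin.init θ'')) * Η (Fin.init (Fin.init θ'')))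
    (x' : Fin k → ℝ) (y' : Fin l'' → ℝ) (Θ₂ : Fin (e + 2) → ℝ) (hx : ∀ i, 0 < x' i ∧ x' i < 1)
    (hy : ∀ j, 0 < y' j ∧ y' j < 1) (hΘ : Θ₂ ∈ openUnitCube (e + 2)) :
    ContinuousOn (fun t : ℝ => ρ₂ Θ₂ * fd a (Ξ₂ Θ₂) (Η₂ Θ₂) / Η₂ Θ₂ *
        (t * Bf (μ ∘ₗ op a) x' (Fin.cons t y') (Ξ₂ Θ₂) (Η₂ Θ₂))) (Icc 0 1) ∧
      (∀ t ∈ Ioo (0 : ℝ) 1, HasDerivAt (fun s : ℝ => ρ₂ Θ₂ * fd a (Ξ₂ Θ₂) (Η₂ Θ₂) / Η₂ Θ₂ *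
          (s * Bf (μ ∘ₗ op a) x' (Fin.cons s y') (Ξ₂ Θ₂) (Η₂ Θ₂)))
        (ρ₂ Θ₂ * (fd a (Ξ₂ Θ₂) (Η₂ Θ₂) * dBf (μ ∘ₗ op a) x' (Fin.cons t y') (Ξ₂ Θ₂) (Η₂ Θ₂))) t) ∧
      ρ₂ Θ₂ * (fd a (Ξ₂ Θ₂) (Η₂ Θ₂) * ∑ b : Fin (m + 2), gd b (Ξ₂ Θ₂) (Η₂ Θ₂) *
          Bf ((μ ∘ₗ op a) ∘ₗ opV b) x' y' (Ξ₂ Θ₂) (Η₂ Θ₂)) =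
        ρ₂ Θ₂ * fd a (Ξ₂ Θ₂) (Η₂ Θ₂) / Η₂ Θ₂ * (1 * Bf (μ ∘ₗ op a) x' (Fin.cons 1 y') (Ξ₂ Θ₂) (Η₂ Θ₂)) -
          ρ₂ Θ₂ * fd a (Ξ₂ Θ₂) (Η₂ Θ₂) / Η₂ Θ₂ * (0 * Bf (μ ∘ₗ op a) x' (Fin.cons 0 y') (Ξ₂ Θ₂) (Η₂ Θ₂)) := by
  -- the point data
  have hy'c : ∀ j, 0 ≤ y' j ∧ y' j ≤ 1 := fun j => ⟨(hy j).1.le, (hy j).2.le⟩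
  have hΘc : Θ₂ ∈ KZ.cube (e + 2) := CornerCubes.openUnitCube_subset_cube hΘ
  have hθ₀c : Fin.init (Fin.init Θ₂) ∈ KZ.cube e := KZ.mem_cube.2 fun i => KZ.mem_cube.1 hΘc _
  obtain ⟨hΞ0, hΞα, hΗ0, hΗβ⟩ := hΞΗ _ hθ₀c
  have hs : 0 < Θ₂ (Fin.castSucc (Fin.last e)) ∧ Θ₂ (Fin.castSucc (Fin.last e)) < 1 := hΘ _
  have hs' : 0 < Θ₂ (Fin.last (e + 1)) ∧ Θ₂ (Fin.last (e + 1)) < 1 := hΘ _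
  obtain ⟨hξ0, hξα⟩ : 0 ≤ Ξ₂ Θ₂ ∧ Ξ₂ Θ₂ ≤ (α : ℝ) := by
    rw [hΞ₂]; exact dilation_range _ _ _ hΞ0 hΞα hs.1.le hs.2.le
  obtain ⟨hη0, hηβ⟩ : 0 ≤ Η₂ Θ₂ ∧ Η₂ Θ₂ ≤ (β : ℝ) := by
    rw [hΗ₂]; exact dilation_range _ _ _ hΗ0 hΗβ hs'.1.le hs'.2.le
  -- the dichotomy forced by the normalisation of `σ`
  have hdich : ρ₂ Θ₂ = 0 ∨ (0 < Ξ₂ Θ₂ ∧ Η₂ Θ₂ ≠ 0) := by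
    by_cases hσ : σ (Fin.init (Fin.init Θ₂)) = 0
    · left; rw [hρ₂, hσ, zero_mul, zero_mul]
    · right
      have hΞne : Ξ (Fin.init (Fin.init Θ₂)) ≠ 0 := fun h => hσ (hσ0 _ hθ₀c (Or.inl h))
      have hΗne : Η (Fin.init (Fin.init Θ₂)) ≠ 0 := fun h => hσ (hσ0 _ hθ₀c (Or.inr h))
      refine ⟨?_, ?_⟩
      · rw [hΞ₂]; exact mul_pos (lt_of_le_of_ne hΞ0 (Ne.symm hΞne)) hs.1
      · rw [hΗ₂]; exact mul_ne_zero hΗne hs'.1.ne'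
  refine ⟨?_, ?_, ?_⟩
  · exact continuousOn_const.mul
      (continuousOn_mul_Bf H (μ ∘ₗ op a) x' y' hy'c _ _ hξ0 hξα hη0 hηβ)
  · intro t ht
    refine ((hasDerivAt_mul_Bf H (μ ∘ₗ op a) x' y' hy'c _ _ hξ0 hξα hη0 hηβ t ht.1 ht.2).const_mul
      (ρ₂ Θ₂ * fd a (Ξ₂ Θ₂) (Η₂ Θ₂) / Η₂ Θ₂)).congr_deriv ?_
    rcases hdich with hρ | ⟨-, hη⟩
    · rw [hρ]; ring
    · field_simp
  · rcases hdich with hρ | ⟨hξ, hη⟩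
    · rw [hρ]; ring
    · rw [CornerEngineMove.starB H (μ ∘ₗ op a) 1 y' x' (Ξ₂ Θ₂) (Η₂ Θ₂) hη one_ne_zero hx hξ hξα]
      simp only [mul_one, one_mul, zero_mul, mul_zero, sub_zero]
      rw [Finset.mul_sum, Finset.mul_sum, Finset.mul_sum]
      refine Finset.sum_congr rfl fun b _ => ?_
      field_simp

end CornerEngineEuler

include H in
/-- **Semialgebraicity of the Euler primitive** `(ρ₂ fd_a / Η₂)(init θ) · θ_last ·
B(x, θ_last :: y; Ξ₂ (init θ), Η₂ (init θ))` on the closed cube `[0,1]^{k+l''+(e+2)+1}`.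
[cite: BochnakCosteRoy1998, Prop. 2.2.6] -/
theorem CornerEngineEuler.euler_sa (μ : (DrinfeldKohnoTrunc ℚ (Fin 4) N) →ₗ[ℚ] ℚ) (k l'' e : ℕ)
    (Ξ Η σ : (Fin e → ℝ) → ℝ)
    (hsaΞ : IsSemialgebraicFunOn ℚ (KZ.cube e) Ξ) (hsaΗ : IsSemialgebraicFunOn ℚ (KZ.cube e) Η)
    (hsaσ : IsSemialgebraicFunOn ℚ (KZ.cube e) σ)
    (a : Fin (m + 2)) (Ξ₂ Η₂ ρ₂ : (Fin (e + 2) → ℝ) → ℝ)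
    (hΞ₂ : ∀ θ'', Ξ₂ θ'' = Ξ (Fin.init (Fin.init θ'')) * θ'' (Fin.castSucc (Fin.last e)))
    (hΗ₂ : ∀ θ'', Η₂ θ'' = Η (Fin.init (Fin.init θ'')) * θ'' (Fin.last (e + 1)))
    (hρ₂ : ∀ θ'', ρ₂ θ'' = σ (Fin.init (Fin.init θ'')) * Ξ (Fin.init (Fin.init θ'')) * Η (Fin.init (Fin.init θ''))) :
    IsSemialgebraicFunOn ℚ (KZ.cube (k + l'' + (e + 2) + 1)) fun z =>
      ρ₂ (Fin.init (Θb k l'' (e + 2 + 1) z)) *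
          fd a (Ξ₂ (Fin.init (Θb k l'' (e + 2 + 1) z))) (Η₂ (Fin.init (Θb k l'' (e + 2 + 1) z))) /
            Η₂ (Fin.init (Θb k l'' (e + 2 + 1) z)) *
        (Θb k l'' (e + 2 + 1) z (Fin.last (e + 2)) *
          Bf (μ ∘ₗ op a) (Xb k l'' (e + 2 + 1) z)
            (Fin.cons (Θb k l'' (e + 2 + 1) z (Fin.last (e + 2))) (Yb k l'' (e + 2 + 1) z))
            (Ξ₂ (Fin.init (Θb k l'' (e + 2 + 1) z))) (Η₂ (Fin.init (Θb k l'' (e + 2 + 1) z)))) := by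
  have H' := H
  obtain ⟨_, _, _, _, _, _, _, _, hXb, hYb, hΘb, _, _, _, _, _, _, _, _, _, _, _, _, _, _, _, _, _, _, _, _, _, _, _,
    _, _, _, hsa_fd, -⟩ := H'
  have hS : IsSemialgebraic ℚ (KZ.cube (k + l'' + (e + 2) + 1)) := KZ.isSemialgebraic_cube
  -- the parameter projections are coordinate maps
  have hθ₀ : ∀ z : Fin (k + l'' + (e + 2) + 1) → ℝ, Fin.init (Fin.init (Fin.init (Θb k l'' (e + 2 + 1) z))) =
      fun i => z (Fin.natAdd (k + l'') (Fin.castSucc (Fin.castSucc (Fin.castSucc i)))) := by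
    intro z; rw [hΘb]; rfl
  have hmem : ∀ z ∈ KZ.cube (k + l'' + (e + 2) + 1),
      (fun i => z (Fin.natAdd (k + l'') (Fin.castSucc (Fin.castSucc (Fin.castSucc i))))) ∈ KZ.cube e :=
    fun z hz => KZ.mem_cube.2 fun i => KZ.mem_cube.1 hz _
  have hσ' : IsSemialgebraicFunOn ℚ (KZ.cube (k + l'' + (e + 2) + 1))
      fun z => σ (Fin.init (Fin.init (Fin.init (Θb k l'' (e + 2 + 1) z)))) := by
    simp_rw [hθ₀]; exact qe_comp_proj _ hsaσ hS hmem
  have hΞ' : IsSemialgebraicFunOn ℚ (KZ.cube (k + l'' + (e + 2) + 1))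
      fun z => Ξ (Fin.init (Fin.init (Fin.init (Θb k l'' (e + 2 + 1) z)))) := by
    simp_rw [hθ₀]; exact qe_comp_proj _ hsaΞ hS hmem
  have hΗ' : IsSemialgebraicFunOn ℚ (KZ.cube (k + l'' + (e + 2) + 1))
      fun z => Η (Fin.init (Fin.init (Fin.init (Θb k l'' (e + 2 + 1) z)))) := by
    simp_rw [hθ₀]; exact qe_comp_proj _ hsaΗ hS hmem
  have hs : IsSemialgebraicFunOn ℚ (KZ.cube (k + l'' + (e + 2) + 1))
      fun z => Fin.init (Θb k l'' (e + 2 + 1) z) (Fin.castSucc (Fin.last e)) := by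
    have : ∀ z : Fin (k + l'' + (e + 2) + 1) → ℝ, Fin.init (Θb k l'' (e + 2 + 1) z) (Fin.castSucc (Fin.last e)) =
        z (Fin.natAdd (k + l'') (Fin.castSucc (Fin.castSucc (Fin.last e)))) := by
      intro z; rw [hΘb]; rfl
    simp_rw [this]; exact CornerSemialg.sa_coord hS _
  have hs' : IsSemialgebraicFunOn ℚ (KZ.cube (k + l'' + (e + 2) + 1))
      fun z => Fin.init (Θb k l'' (e + 2 + 1) z) (Fin.last (e + 1)) := by
    have : ∀ z : Fin (k + l'' + (e + 2) + 1) → ℝ, Fin.init (Θb k l'' (e + 2 + 1) z) (Fin.last (e + 1)) =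
        z (Fin.natAdd (k + l'') (Fin.castSucc (Fin.last (e + 1)))) := by
      intro z; rw [hΘb]; rfl
    simp_rw [this]; exact CornerSemialg.sa_coord hS _
  have hy₀ : IsSemialgebraicFunOn ℚ (KZ.cube (k + l'' + (e + 2) + 1))
      fun z => Θb k l'' (e + 2 + 1) z (Fin.last (e + 2)) := by
    have : ∀ z : Fin (k + l'' + (e + 2) + 1) → ℝ, Θb k l'' (e + 2 + 1) z (Fin.last (e + 2)) =
        z (Fin.natAdd (k + l'') (Fin.last (e + 2))) := by
      intro z; rw [hΘb]
    simp_rw [this]; exact CornerSemialg.sa_coord hS _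
  have hΞ₂' : IsSemialgebraicFunOn ℚ (KZ.cube (k + l'' + (e + 2) + 1))
      fun z => Ξ₂ (Fin.init (Θb k l'' (e + 2 + 1) z)) := by
    simp_rw [hΞ₂]; exact hΞ'.fun_mul hs
  have hΗ₂' : IsSemialgebraicFunOn ℚ (KZ.cube (k + l'' + (e + 2) + 1))
      fun z => Η₂ (Fin.init (Θb k l'' (e + 2 + 1) z)) := by
    simp_rw [hΗ₂]; exact hΗ'.fun_mul hs'
  have hρ₂' : IsSemialgebraicFunOn ℚ (KZ.cube (k + l'' + (e + 2) + 1))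
      fun z => ρ₂ (Fin.init (Θb k l'' (e + 2 + 1) z)) := by
    simp_rw [hρ₂]; exact (hσ'.fun_mul hΞ').fun_mul hΗ'
  have hC := CornerSemialg.sa_div (hρ₂'.fun_mul (hsa_fd hS a hΞ₂' hΗ₂')) hΗ₂'
  -- the transport
  have hX : ∀ i, IsSemialgebraicFunOn ℚ (KZ.cube (k + l'' + (e + 2) + 1)) fun z => Xb k l'' (e + 2 + 1) z i := by
    intro i; simp_rw [hXb]; exact CornerSemialg.sa_coord hS _
  have hY : ∀ j, IsSemialgebraicFunOn ℚ (KZ.cube (k + l'' + (e + 2) + 1)) fun z =>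
      (Fin.cons (Θb k l'' (e + 2 + 1) z (Fin.last (e + 2))) (Yb k l'' (e + 2 + 1) z) : Fin (l'' + 1) → ℝ) j := by
    intro j
    refine Fin.cases ?_ (fun j' => ?_) j
    · simp only [Fin.cons_zero]; exact hy₀
    · simp only [Fin.cons_succ]; simp_rw [hYb]; exact CornerSemialg.sa_coord hS _
  have hB := qe_sa_Bf H hS (μ ∘ₗ op a) hX hY hΞ₂' hΗ₂'
  exact hC.fun_mul (hy₀.fun_mul hB)

include H in
/-- **Step A.3 (Euler step).** [cite: KontsevichZagier2001, §1.2 rules (2), (3)] -/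
theorem stepA_euler (μ : (DrinfeldKohnoTrunc ℚ (Fin 4) N) →ₗ[ℚ] ℚ) (k l'' e : ℕ) (Ξ Η σ : (Fin e → ℝ) → ℝ)
    (hΞΗ : ∀ θ ∈ KZ.cube e, 0 ≤ Ξ θ ∧ Ξ θ ≤ (α : ℝ) ∧ 0 ≤ Η θ ∧ Η θ ≤ (β : ℝ))
    (hσ0 : ∀ θ ∈ KZ.cube e, Ξ θ = 0 ∨ Η θ = 0 → σ θ = 0)
    (hsaΞ : IsSemialgebraicFunOn ℚ (KZ.cube e) Ξ) (hsaΗ : IsSemialgebraicFunOn ℚ (KZ.cube e) Η)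
    (hsaσ : IsSemialgebraicFunOn ℚ (KZ.cube e) σ)
    (a : Fin (m + 2))
    (Ξ₂ Η₂ ρ₂ : (Fin (e + 2) → ℝ) → ℝ)
    (hΞ₂ : ∀ θ'', Ξ₂ θ'' = Ξ (Fin.init (Fin.init θ'')) * θ'' (Fin.castSucc (Fin.last e)))
    (hΗ₂ : ∀ θ'', Η₂ θ'' = Η (Fin.init (Fin.init θ'')) * θ'' (Fin.last (e + 1)))
    (hρ₂ : ∀ θ'', ρ₂ θ'' = σ (Fin.init (Fin.init θ'')) * Ξ (Fin.init (Fin.init θ'')) * Η (Fin.init (Fin.init θ'')))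
    (W₂ : KZ.IntegralRep (k + (l'' + 1) + (e + 2))) (hW₂d : W₂.domain = KZ.cube (k + (l'' + 1) + (e + 2)))
    (hW₂i : W₂.integrand = fun w => ρ₂ (Θb k (l'' + 1) (e + 2) w) *
      (fd a (Ξ₂ (Θb k (l'' + 1) (e + 2) w)) (Η₂ (Θb k (l'' + 1) (e + 2) w)) *
        dBf (μ ∘ₗ op a) (Xb k (l'' + 1) (e + 2) w) (Yb k (l'' + 1) (e + 2) w)
          (Ξ₂ (Θb k (l'' + 1) (e + 2) w)) (Η₂ (Θb k (l'' + 1) (e + 2) w))))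
    (E : KZ.IntegralRep (k + l'' + (e + 2))) (hEd : E.domain = KZ.cube (k + l'' + (e + 2)))
    (hEi : E.integrand = fun w => ρ₂ (Θb k l'' (e + 2) w) *
      (fd a (Ξ₂ (Θb k l'' (e + 2) w)) (Η₂ (Θb k l'' (e + 2) w)) *
        ∑ b : Fin (m + 2), gd b (Ξ₂ (Θb k l'' (e + 2) w)) (Η₂ (Θb k l'' (e + 2) w)) *
          Bf ((μ ∘ₗ op a) ∘ₗ opV b) (Xb k l'' (e + 2) w) (Yb k l'' (e + 2) w)
            (Ξ₂ (Θb k l'' (e + 2) w)) (Η₂ (Θb k l'' (e + 2) w)))) :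
    KZ.toPeriodAlgebra (KZ.toFormalPeriod (KZ.of W₂)) = KZ.toPeriodAlgebra (KZ.toFormalPeriod (KZ.of E)) := by
  -- (1) move `y₀` to the last slot (rule (2))
  obtain ⟨W, hWd, hWi, hWc⟩ := CornerEngineMove.moveY0_rep H (k := k) (l := l'') (e := e + 2)
    (fun x y θ => ρ₂ θ * (fd a (Ξ₂ θ) (Η₂ θ) * dBf (μ ∘ₗ op a) x y (Ξ₂ θ) (Η₂ θ))) W₂ hW₂d hW₂i
  rw [← hWc]
  -- the blocks of `snoc w t`
  have h1 : ∀ (w : Fin (k + l'' + (e + 2)) → ℝ) (t : ℝ),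
      Xb k l'' (e + 2 + 1) (Fin.snoc w t : Fin (k + l'' + (e + 2) + 1) → ℝ) = Xb k l'' (e + 2) w :=
    fun w t => (CornerEngineMove.snoc_blocks H w t).1
  have h2 : ∀ (w : Fin (k + l'' + (e + 2)) → ℝ) (t : ℝ),
      Yb k l'' (e + 2 + 1) (Fin.snoc w t : Fin (k + l'' + (e + 2) + 1) → ℝ) = Yb k l'' (e + 2) w :=
    fun w t => (CornerEngineMove.snoc_blocks H w t).2.1
  have h4 : ∀ (w : Fin (k + l'' + (e + 2)) → ℝ) (t : ℝ),
      Θb k l'' (e + 2 + 1) (Fin.snoc w t : Fin (k + l'' + (e + 2) + 1) → ℝ) (Fin.last (e + 2)) = t :=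
    fun w t => (CornerEngineMove.snoc_blocks H w t).2.2.2.1
  have h5 : ∀ (w : Fin (k + l'' + (e + 2)) → ℝ) (t : ℝ),
      Fin.init (Θb k l'' (e + 2 + 1) (Fin.snoc w t : Fin (k + l'' + (e + 2) + 1) → ℝ)) = Θb k l'' (e + 2) w :=
    fun w t => (CornerEngineMove.snoc_blocks H w t).2.2.2.2
  -- (2) Newton–Leibniz along `y₀` (rule (3)), hypotheses over the open base cube
  refine CornerCubes.cls_newtonLeibniz_open W E _ hWd hEd
    (CornerEngineEuler.euler_sa H μ k l'' e Ξ Η σ hsaΞ hsaΗ hsaσ a Ξ₂ Η₂ ρ₂ hΞ₂ hΗ₂ hρ₂) ?_ ?_ ?_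
  · intro w hw
    obtain ⟨hxo, hyo, hΘo⟩ := CornerEngineEuler.blocks_open H hw
    simp only [h1, h2, h4, h5]
    exact (CornerEngineEuler.euler_point H μ k l'' e Ξ Η σ hΞΗ hσ0 a Ξ₂ Η₂ ρ₂ hΞ₂ hΗ₂ hρ₂ _ _ _
      hxo hyo hΘo).1
  · intro w hw t ht
    obtain ⟨hxo, hyo, hΘo⟩ := CornerEngineEuler.blocks_open H hw
    simp only [hWi, h1, h2, h4, h5]
    exact (CornerEngineEuler.euler_point H μ k l'' e Ξ Η σ hΞΗ hσ0 a Ξ₂ Η₂ ρ₂ hΞ₂ hΗ₂ hρ₂ _ _ _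
      hxo hyo hΘo).2.1 t ht
  · intro w hw
    obtain ⟨hxo, hyo, hΘo⟩ := CornerEngineEuler.blocks_open H hw
    simp only [hEi, h1, h2, h4, h5]
    exact (CornerEngineEuler.euler_point H μ k l'' e Ξ Η σ hΞΗ hσ0 a Ξ₂ Η₂ ρ₂ hΞ₂ hΗ₂ hρ₂ _ _ _
      hxo hyo hΘo).2.2

end AbstractEngine

/-- **Hook `cornerEngineEuler_dilation_range`** (registered form of
`CornerEngineEuler.dilation_range`): ranges of the dilations `Ξ s`, `Η s'` for `s, s' ∈ [0,1]`.
[folklore] -/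
theorem cornerEngineEuler_dilation_range : ∀ (a c s : ℝ), 0 ≤ a → a ≤ c → 0 ≤ s → s ≤ 1 → 0 ≤ a * s ∧ a * s ≤ c :=
  fun a c s ha hc hs hs1 => CornerEngineEuler.dilation_range a c s ha hc hs hs1

end Summit.KontsevichZagierPeriods.FurushoPentagon.PentagonInKZ
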